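import Mathlib.Analysis.Normed.Algebra.MatrixExponential
import Literature.Analysis.Fourier.LpMultiplier
import Literature.Barriers.AtomisticToContinuum.NoBVEstimatesMultiDProofs
import HarnessLib

/-!
# Rauch's theorem, linear constant-coefficient step: its two printed ingredients

Companion to `NoBVEstimatesMultiDProofs.lean`, which vendors as the named fact
`Rauch1986_linearL1EstimateForcesCommutation` the step "(5) ⟹ (3)" of [Rauch1986, Proof of
Theorem p. 483]: for a constant-coefficient system `A₀∂ₜv + Σ Aⱼ∂ⱼv + B₁v = 0` in Rauch's class,
the `L¹` gradient estimate (5) `‖∇ₓv(T)‖_{L¹} ≤ c‖∇ₓφ‖_{L¹}` (`φ ∈ C₀^∞`) at one time `T > 0`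
forces `[A₀⁻¹Aⱼ, A₀⁻¹A_l] = 0`. The printed argument has two parts, vendored here as named facts,
both WITHOUT zeroth-order term (`B₁ = 0`, see the two scope paragraphs below):

1. `Rauch1986_L1GradientEstimate_imp_LpMultiplier` — Rauch's reduction [Rauch1986, p. 483,
   (5)–(6) and the following paragraph]: with `M(ξ) = exp(t̄A₀⁻¹(-Σ A_l iξ_l - B′))` the solution
   is `v(t̄) = M(D)φ`; from (5), "the hyperbolicity of (1) shows that (5) is valid with `L¹`
   replaced by `L²` ... Interpolating, (5) is valid for `Lᵖ`, `1 < p < 2` ... for `1 < p < ∞`,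
   `Dⱼ/|D|` is a bounded operator on `Lᵖ(ℝⁿ)` so ... `D_l M^{αβ}(D)/|D|` is a bounded operator on
   `Lᵖ` for all `1 < p ≤ 2`. To show that `M(D)` is itself bounded, multiply by
   `D_l/|D| ∈ Hom(Lᵖ)` and sum on `l`." Conclusion: `M ∈ M_p` for every `1 < p ≤ 2`
   (`IsLpMultiplier`, `Literature/Analysis/Fourier/LpMultiplier.lean`); vendored for the system
   `A₀∂ₜv + Σⱼ Aⱼ∂ⱼv = 0`, `M_T = rauchSymbol A₀ A 0 T`.
2. `Rauch1986_LpMultiplier_forces_commutation` — the theorem behind "We now appeal to the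
   result of Brenner [1, 2] which states that (3) is a necessary and sufficient condition for `M`
   to be an `Lᵖ` multiplier for some `1 < p < ∞`, `p ≠ 2`" [Rauch1986, p. 483], AS PRINTED BY
   BRENNER: [Brenner1973, Cor 3.1 p. 84] "Let `p ≠ 2` and let `P` be a homogeneous matrix
   polynomial of degree `d > 0` with real eigenvalues. Then `exp(iP) ∈ M_p^{N,N}` if and only if
   `P(y) = Σⱼ Aⱼyⱼ` where `A₁, …, A_n` are diagonable, commuting matrices with real eigenvalues"
   (necessity half; symmetric case [BrennerThomeeWahlbin1975, Ch. 5 §1 Lemmas 1.1–1.2]), applied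
   to the homogeneous pencil `P(ξ) = -2πT Σ_l ξ_l A₀⁻¹A_l` of Rauch's multiplier WITHOUT
   zeroth-order term, `rauchSymbol A₀ A 0 T ξ = exp(iP(ξ))`: `M_T ∈ M_p`, `p ≠ 2`, forces
   `[A₀⁻¹Aⱼ, A₀⁻¹A_l] = 0`.

**Scope of ingredient 2 (split review 2026-08-15).** An earlier version of this file stated
ingredient 2 with a zeroth-order term `B₁` at the single time `T`, which is what the last
sentence of [Rauch1986, p. 483] asserts for `M = exp(t̄A₀⁻¹(-Σ A_l iξ_l - B′(ū)))`. That is not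
what Brenner proves: with lower-order terms his hypothesis is well-posedness in `L_p`, the bound
`M_p(exp(tP)) ≤ C(T)` for ALL `0 < t ≤ T` [Brenner1973, (5.4) p. 92, Lemma 5.1 (5.12) p. 96,
Thm 5.1 p. 93], and the lower-order terms are removed by letting `t → 0` [Brenner1973, Lemma 5.2
p. 97] before Cor 3.1 is invoked [Brenner1973, Proof of Thm 5.1 p. 98]. A bound at the one time
`T` yields, by dilation invariance of `M_p` [BrennerThomeeWahlbin1975, Ch. 1 Thm 2.8], bounds
for `exp(τP₁(ξ) - TA₀⁻¹B₁)`, `τ > 0` (`P₁(ξ) = -2πiΣξ_lA₀⁻¹A_l`), not for `exp(tP)`, `t → 0`;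
no printed source known to us closes this gap (cf. `NoBVEstimatesMultiD.lean`, `scope_caveats`
(e), where a folklore repair via `Lᵖ` bounds for Fourier integral operators is sketched). For
`B₁ = 0` the symbol is `exp(iP)` with `P` homogeneous of degree one and Cor 3.1 applies at the
single time verbatim. Ingredient 2 is therefore vendored for `B₁ = 0` only, and the two
ingredients assemble to the case `B₁ = 0` of `Rauch1986_linearL1EstimateForcesCommutation`
(`Rauch1986_linearL1EstimateForcesCommutation_zero_of_linearFacts`) — the case of every
linearisation `B′(ū) = 0`, in particular of all systems of conservation laws without source
term (the compressible Euler equations of the barrier's `blocks`). The case `B′(ū) ≠ 0` of that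
fact rests on Rauch's printed assertion alone and is not assembled here.

**Scope and status of ingredient 1 (split review 2026-08-15).** (a) Ingredient 1 is printed for
the linearisation (4), zeroth-order term `B′(ū)` included, and is a true statement in that
generality; it is vendored for `B₁ = 0` only, because that is the only case the assembly can
consume once ingredient 2 is restricted to `B₁ = 0` (an ingredient 1 with `B₁` would keep the
`B₁ = 0` assembly waiting for a discharge of its `B₁ ≠ 0` part, which feeds nothing in the tree).
(b) The printed proof of ingredient 1 is incomplete at "Interpolating, (5) is valid for `Lᵖ`,
`1 < p < 2`": estimate (5) is a bound for `M(D)` on the subspace of gradient fields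
`{∇φ : φ ∈ C₀^∞}` of `L¹(ℝᵈ; ℂ^{kd})`, to which the Riesz–Thorin theorem does not apply as such;
what the step uses is that the homogeneous Sobolev space `Ẇ¹_p` is an interpolation space
between `Ẇ¹₁` and `Ẇ¹₂` — recorded, with its source [Badr2009, Thm 1.4, Cor 5.9], as the named
fact `Literature.Analysis.Fourier.gradientLpBound_interpolation` of
`Literature/Analysis/Fourier/SobolevMultiplierBound.lean`, a theory of its own (`K`-functionals of
Sobolev couples) that is neither in Mathlib nor in the tree. Along the printed route ingredient 1
is the composite of: (5) for `v(T) = M_T(D)φ` (uniqueness of compactly supported classical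
solutions and the Fourier representation, PROVED in `NoBVEstimatesMultiDFourierRepresentation.lean`
from finite propagation speed — `Rauch1986_finitePropagationSpeed_symmetrizable_holds`, the cases
`d ≤ 1`, `k ≤ 1` of `NoBVEstimatesMultiDFinitePropagationOneD.lean`, and the named fact
`Rauch1986_finitePropagationSpeed_strictlyHyperbolic` for `d, k ≥ 2`), the `L²` bound for
bounded symbols (`Literature.Analysis.Fourier.hasGradientLpBoundWith_two_of_bounded`, proved),
the interpolation fact just named, and Rauch's (6) with the Riesz transforms
(`Literature.Analysis.Fourier.isLpMultiplier_of_gradientLpBound`, named fact;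
`rieszTransform_isLpMultiplier_holds` is proved). (c) An interpolation-free proof of ingredient 1
(and of the `B₁ = 0` case of the linear step) is available from the sources as printed, because
Brenner's necessity proof consumes much less than `M_T ∈ M_p`: the proof of
[BrennerThomeeWahlbin1975, Ch. 5 Lemma 1.1] (valid for every `1 ≤ p ≤ ∞`, `p ≠ 2`, so also for
`p = 1`; likewise [Brenner1973, Thm 3.1′ and Cor 3.1 for `p = 1, ∞`, p. 84]) uses the hypothesis
`exp(P̂) ∈ M_p` only through (1.5), `M_p(χ e^{inλ}) ≤ M_p(exp(nP̂)) M_p(χv) M_p(w*)`, i.e. through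
bounds, uniform in `n`, for the LOCALISED DILATES `χ(ξ) exp(P̂(nξ))`, `χ ∈ C₀^∞(B)`, `B` a small
ball [BrennerThomeeWahlbin1975, Ch. 5 §1, proof of Lemma 1.1, (1.5)]. Such bounds follow from (5)
at `p = 1` by Young's inequality alone: if `B ⊂ {ξ : ξ_l ≠ 0}` and `f ∈ 𝒮`, then
`φ = 𝓕⁻¹(χ(ξ/n) f̂(ξ)/(2πiξ_l)) ∈ 𝒮` has `∂_lφ = (χ(·/n))(D)f` and
`∂ⱼφ = ((ξⱼ/ξ_l)χ(·/n))(D)f`, so (5) for `M_T(D)` (extended from `C₀^∞` to `𝒮` by cut-off and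
Fatou) gives `‖(χ(·/n)M_T)(D)f‖₁ = ‖M_T(D)∂_lφ‖₁ ≤ c Σⱼ ‖∂ⱼφ‖₁ ≤ c (Σⱼ ‖𝓕⁻¹((ξⱼ/ξ_l)χ)‖₁) ‖f‖₁`
uniformly in `n ≠ 0` (`C₀^∞ ⊂ M_1` with `M_1(σ) ≤ ‖𝓕⁻¹σ‖₁` [BrennerThomeeWahlbin1975, Ch. 1
Thm 2.3], dilation invariance [loc. cit., Ch. 1 Thm 2.8]). Hence: (5) ⟹ localised `M_1` bounds
⟹ (proof of Lemma 1.1 at `p = 1`: rescaling `h_n`, limits [loc. cit., Ch. 1 Thm 2.6],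
`e^{iQ} ∉ M_p` for `p ≠ 2` [loc. cit., Ch. 1 Cor 5.3]) linear eigenvalues (1.4) ⟹ (Lemma 1.2,
resp. impossibility for strictly hyperbolic pencils with `d, k ≥ 2`) the commutation relations
(3) ⟹ (sufficiency [loc. cit., Ch. 5 Thm 1.1]: commuting diagonable pencils give symbols
conjugate to diagonal matrices of characters) `M_T ∈ M_p` for every `1 ≤ p ≤ ∞`, in particular
ingredient 1. In-tree tools for this route: `LpMultiplierSchwartz`/`LpMultiplierSchwartzTop`
(Thm 2.3), `LpMultiplierDilation` (Thm 2.8), `LpMultiplierTranslation`, `LpMultiplierProduct`,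
`LpMultiplierConstant`, `LpMultiplierLimit` (Thm 2.6), `QuadraticPhaseMultiplier`
(Cor 5.3 for quadratic forms, `1 ≤ p < 2`), `HyperbolicSystemsLpSufficiency` (Thm 1.1,
sufficiency), `Literature/LinearAlgebra/Matrix/LinearEigenvaluesCommute.lean` (Lemma 1.2) and
`StrictlyHyperbolicPencil.lean`, and the reductions of `NoBVEstimatesMultiDLinearStepReduction.lean`
/ `NoBVEstimatesMultiDLinearStepSymmetric.lean` (phase symbols of dilates, conjugation to a
symmetric pencil, `rauchSymbol_one_zero`, `rauchSymbol_zero_of_conj`); not yet in the tree: the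
localised form of Lemma 1.1 itself (smooth eigenvalue branches on a ball of constant
multiplicities, the rescaling argument), which also discharges ingredient 2 and
`BTW1975_hasLinearEigenvalues_of_isLpMultiplier`.

## Contents

* `rauchGenerator A₀ A B₁ ξ = A₀⁻¹(2πi Σ_l ξ_l A_l + B₁)` and Rauch's multiplier
  `rauchSymbol A₀ A B₁ T ξ = exp(-T · rauchGenerator A₀ A B₁ ξ)` (Mathlib's normalisation of
  `𝓕`, `∂_l ↔ 2πiξ_l`; general `B₁`, as used by the Fourier representation); `rauchSymbol_zero`
  (`M_0 = 1`).
* the two named facts (both for `B₁ = 0`) and the assembly for `B₁ = 0`.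

What is NOT here: proofs of the two facts (see the two scope paragraphs: along the printed route
1 needs the interpolation of homogeneous Sobolev spaces; both follow from the localised form of
[BrennerThomeeWahlbin1975, Ch. 5 Lemma 1.1], not yet in the tree). In-tree progress on 2 (files
importing this one): the symmetrizable branch is reduced to [BrennerThomeeWahlbin1975, Ch. 5
Lemma 1.1] (`BTW1975_hasLinearEigenvalues_of_isLpMultiplier`) in
`NoBVEstimatesMultiDLinearStepSymmetric.lean` (`lpMultiplier_forces_commutation_symmetrizable_of_BTW`);
dilation to uniform phase families and the conjugation bookkeeping of both branches are in
`NoBVEstimatesMultiDLinearStepReduction.lean`; for the strictly hyperbolic branch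
`IsStrictlyHyperbolicPencil.not_hasLinearEigenvalues`
(`Literature/LinearAlgebra/Matrix/StrictlyHyperbolicPencil.lean`) leaves "`M_p`-boundedness of
`exp(-iK(ξ))` forces linear eigenvalues" for strictly hyperbolic pencils
[Brenner1973, Thm 3.1 p. 84, Prop 3.1 p. 87]. In-tree progress on 1: the Fourier representation
and the `L²` bound named in the scope paragraph.

## References

* [Rauch1986] J. Rauch, Comm. Math. Phys. 106 (1986) 481–484: Proof of Theorem p. 483, (5), (6).
* [Brenner1973] P. Brenner, Ark. Mat. 11 (1973) 75–101: (0.3) p. 75, Thm 0.1 p. 76, §1 p. 78,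
  Thm 3.1, Thm 3.1′ and Cor 3.1 pp. 84–85, Prop 3.1 p. 87, (5.4) p. 92, Thm 5.1 p. 93,
  Lemma 5.1 (5.12) p. 96, Lemma 5.2 p. 97, Proof of Thm 5.1 p. 98.
* [BrennerThomeeWahlbin1975] P. Brenner, V. Thomée, L. B. Wahlbin, LNM 434 (1975): Ch. 1
  Thms 2.3, 2.6, 2.8, Cor 5.3; Ch. 5 §1 Thm 1.1, Lemmas 1.1–1.2 and the proof of Lemma 1.1 with
  (1.5), pp. 91–95.
* [Badr2009] N. Badr, Math. Scand. 105 (2009) 235–264 (arXiv:0705.2216): Thm 1.4, Cor 5.9 (as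
  recorded in `Literature/Analysis/Fourier/SobolevMultiplierBound.lean`).
-/

noncomputable section

open MeasureTheory Set Filter
open scoped ENNReal NNReal ContDiff

namespace Literature.Barriers.AtomisticToContinuum

open Literature.Analysis.FluidPDE Literature.Analysis.Fourier QuasilinearSystem

variable {d k : ℕ}

/-! ### Rauch's multiplier `M(ξ)` -/

/-- The generator `A₀⁻¹(2πi Σ_l ξ_l A_l + B₁)` (complexified): the spatial Fourier transform of a
solution of `A₀∂ₜv + Σ_l A_l∂_l v + B₁v = 0` obeys `∂ₜv̂(t, ξ) = -A₀⁻¹(2πi Σ_l ξ_l A_l + B₁) v̂(t, ξ)`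
(Mathlib's `𝓕f(ξ) = ∫ e^{-2πi⟨x,ξ⟩} f(x) dx`, so `∂_l ↔ 2πiξ_l`; Rauch and Brenner write `iξ_l`).
[cite: Rauch1986, Proof of Theorem p. 483] -/
def rauchGenerator (A₀ : Matrix (Fin k) (Fin k) ℝ) (A : Fin d → Matrix (Fin k) (Fin k) ℝ)
    (B₁ : (Fin k → ℝ) →L[ℝ] (Fin k → ℝ)) (ξ : Space d) : Matrix (Fin k) (Fin k) ℂ :=
  (A₀⁻¹).map (algebraMap ℝ ℂ) *
    (∑ l, (2 * Real.pi * ξ l * Complex.I) • (A l).map (algebraMap ℝ ℂ) +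
      (LinearMap.toMatrix' (B₁ : (Fin k → ℝ) →ₗ[ℝ] (Fin k → ℝ))).map (algebraMap ℝ ℂ))

/-- **Rauch's multiplier** `M(ξ) = exp(t̄ A₀⁻¹(-Σ_l A_l iξ_l - B′))`, here
`rauchSymbol A₀ A B₁ T ξ = exp(-T · A₀⁻¹(2πi Σ_l ξ_l A_l + B₁))`: the symbol of the solution
operator `φ ↦ v(T)` of the constant-coefficient system `ofConstant A₀ A B₁`,
`v̂(T, ξ) = M_T(ξ) φ̂(ξ)`. [cite: Rauch1986, Proof of Theorem p. 483] -/
def rauchSymbol (A₀ : Matrix (Fin k) (Fin k) ℝ) (A : Fin d → Matrix (Fin k) (Fin k) ℝ)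
    (B₁ : (Fin k → ℝ) →L[ℝ] (Fin k → ℝ)) (T : ℝ) (ξ : Space d) : Matrix (Fin k) (Fin k) ℂ :=
  NormedSpace.exp (-(T : ℂ) • rauchGenerator A₀ A B₁ ξ)

/-- At time `0` the multiplier is the identity, `M_0 = 1`. [cite: Rauch1986, Proof of Theorem p. 483] -/
@[simp] theorem rauchSymbol_zero (A₀ : Matrix (Fin k) (Fin k) ℝ)
    (A : Fin d → Matrix (Fin k) (Fin k) ℝ) (B₁ : (Fin k → ℝ) →L[ℝ] (Fin k → ℝ)) :
    rauchSymbol A₀ A B₁ 0 = 1 := by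
  funext ξ
  simp [rauchSymbol, NormedSpace.exp_zero]

/-! ### The two printed ingredients (named facts, no zeroth-order term) -/

/-- **Rauch's reduction, without zeroth-order term: the `L¹` gradient estimate (5) makes
`M_T(D)` bounded on `Lᵖ`, `1 < p ≤ 2`** (named fact, NOT proved here). For a constant-coefficient
system `A₀∂ₜv + Σⱼ Aⱼ∂ⱼv = 0` in Rauch's class at `0` (symmetrizable, or `A₀` invertible and
strictly hyperbolic) and `c, T > 0`: if for every `φ ∈ C₀^∞(ℝᵈ; ℝᵏ)` there is a classical
solution `v` on `[0, T]` with `v(0) = φ`, `v(T)` compactly supported and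
`∫ ‖∇ₓv(T)‖ ≤ c ∫ ‖∇ₓφ‖` (Rauch's (5); the solution being unique, `v(T) = M_T(D)φ` with
`M_T = rauchSymbol A₀ A 0 T = exp(-2πiT Σ_l ξ_l A₀⁻¹A_l)`), then `M_T` is an `Lᵖ` Fourier
multiplier for every `1 < p ≤ 2`: "the hyperbolicity of (1) shows that (5) is valid with `L¹`
replaced by `L²` ... Interpolating, (5) is valid for `Lᵖ`, `1 < p < 2` ... `Dⱼ/|D|` is a bounded
operator on `Lᵖ(ℝⁿ)` so ... `D_l M^{αβ}(D)/|D|` is a bounded operator on `Lᵖ(ℝⁿ)` for all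
`1 < p ≤ 2`. To show that `M(D)` is itself bounded, multiply by `D_l/|D| ∈ Hom(Lᵖ)` and sum on
`l`." Printed for Rauch's `M = exp(t̄A₀⁻¹(-Σ A_l iξ_l - B′))`, zeroth-order term included, and
true in that generality; vendored for `B′ = 0`, the case consumed by the assembly with Brenner's
Corollary 3.1 (module docstring, scope paragraphs). Status of the proof (module docstring,
"Scope and status of ingredient 1"): the printed interpolation step is an interpolation of the
homogeneous Sobolev spaces, not of `Lᵖ` [Badr2009, Thm 1.4, Cor 5.9]
(`Literature.Analysis.Fourier.gradientLpBound_interpolation`); independently of it, (5) gives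
uniform `M_1` bounds for the localised dilates `χ(ξ)M_T(nξ)` by Young's inequality, which is all
that the proof of [BrennerThomeeWahlbin1975, Ch. 5 Lemma 1.1, (1.5)] consumes at `p = 1`, so
that (5) forces the commutation relations (3) and then, by the sufficiency half of
[BrennerThomeeWahlbin1975, Ch. 5 Thm 1.1], `M_T ∈ M_p` for all `1 ≤ p ≤ ∞`.
[cite: Rauch1986, Proof of Theorem p. 483, (5)–(6)] -/
def Rauch1986_L1GradientEstimate_imp_LpMultiplier : Prop :=
  ∀ ⦃d k : ℕ⦄ (A₀ : Matrix (Fin k) (Fin k) ℝ) (A : Fin d → Matrix (Fin k) (Fin k) ℝ),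
    (ofConstant A₀ A 0).IsRauchClass 0 →
    ∀ (c T : ℝ), 0 < c → 0 < T →
      (∀ φ : Space d → Fin k → ℝ, ContDiff ℝ ∞ φ → HasCompactSupport φ →
        ∃ v : ℝ → Space d → Fin k → ℝ,
          (ofConstant A₀ A 0).IsClassicalSolution T v ∧ (∀ x, v 0 x = φ x) ∧
          HasCompactSupport (v T) ∧
          ∫ x, ‖fderiv ℝ (v T) x‖ ≤ c * ∫ x, ‖fderiv ℝ φ x‖) →
      ∀ p : ℝ≥0∞, 1 < p → p ≤ 2 → IsLpMultiplier p (rauchSymbol A₀ A 0 T)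

/-- **Brenner's theorem behind Rauch's appeal, without zeroth-order term: if
`M_T = exp(-2πiT Σ_l ξ_l A₀⁻¹A_l)` is an `Lᵖ` multiplier for some `1 < p < ∞`, `p ≠ 2`, then
the `A₀⁻¹Aⱼ` commute** (named fact, NOT proved here). [Brenner1973, Cor 3.1 p. 84]: "Let
`p ≠ 2` and let `P` be a homogeneous matrix polynomial of degree `d > 0` with real eigenvalues.
Then `exp(iP) ∈ M_p^{N,N}` if and only if `P(y) = Σⱼ₌₁ⁿ Aⱼyⱼ` (3.2) where `A₁, …, A_n` are
diagonable, commuting matrices with real eigenvalues" (necessity half; proof p. 85 from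
Thm 3.1: the powers `exp(imP)` are dilates of `exp(iP)`, hence uniformly in `M_p`, which forces
`P = Σ αⱼEⱼ` with real linear `αⱼ` and idempotents `Eⱼ`; symmetric case
[BrennerThomeeWahlbin1975, Ch. 5 §1 Lemmas 1.1–1.2]). Applied to the constant-coefficient
system `A₀∂ₜv + Σⱼ Aⱼ∂ⱼv = 0` in Rauch's class at `0` (symmetrizable, or `A₀` invertible and
strictly hyperbolic — in either case `P(ξ) = -2πT Σ_l ξ_l A₀⁻¹A_l` is a homogeneous matrix
polynomial of degree one with real eigenvalues, "the eigenvalues of `P_d(y)` are imaginary")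
and `T > 0`: Rauch's multiplier is `rauchSymbol A₀ A 0 T ξ = exp(-T A₀⁻¹(2πi Σ ξ_l A_l))
= exp(iP(ξ))`, so `M_T ∈ M_p`, `p ≠ 2`, gives (3.2), and comparing the coefficients of the
degree-one polynomial, `-2πT A₀⁻¹Aⱼ = A'ⱼ` commute. This is the necessity half of "the result
of Brenner [1, 2] which states that (3) is a necessary and sufficient condition for `M` to be
an `Lᵖ` multiplier for some `1 < p < ∞`, `p ≠ 2`" [Rauch1986, p. 483] for Rauch's
`M = exp(t̄A₀⁻¹(-Σ A_l iξ_l - B′))` when `B′ = 0`; stated for Rauch's range `1 < p < ∞`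
(Brenner: `1 ≤ p ≤ ∞`).
Scope (split review 2026-08-15): the zeroth-order term is NOT included. With `B₁ ≠ 0` the
single-time statement is asserted in [Rauch1986, p. 483] but Brenner's theorem with lower-order
terms [Brenner1973, Thm 5.1 p. 93] assumes the bound `M_p(exp(tP)) ≤ C(T)` for all
`0 < t ≤ T` [Brenner1973, (5.4), (5.12)] and removes the lower-order terms by `t → 0`
[Brenner1973, Lemma 5.2 p. 97]; from the single time `T` dilation [BrennerThomeeWahlbin1975,
Ch. 1 Thm 2.8] only reaches `exp(τP₁ - TA₀⁻¹B₁)`, `τ > 0`. No printed proof of the single-time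
statement with `B₁ ≠ 0` is known to us (see the module docstring and `NoBVEstimatesMultiD.lean`
`scope_caveats` (e)).
[cite: Brenner1973, Cor 3.1 p. 84 (with Thm 3.1 p. 84, proof p. 85); Rauch1986, Proof of
Theorem p. 483 (last sentence); BrennerThomeeWahlbin1975, Ch. 5 §1 Thm 1.1, Lemmas 1.1–1.2] -/
def Rauch1986_LpMultiplier_forces_commutation : Prop :=
  ∀ ⦃d k : ℕ⦄ (A₀ : Matrix (Fin k) (Fin k) ℝ) (A : Fin d → Matrix (Fin k) (Fin k) ℝ),
    (ofConstant A₀ A 0).IsRauchClass 0 →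
    ∀ (T : ℝ) (p : ℝ≥0∞), 0 < T → 1 < p → p < ⊤ → p ≠ 2 →
      IsLpMultiplier p (rauchSymbol A₀ A 0 T) →
      ∀ j l : Fin d, Commute (A₀⁻¹ * A j) (A₀⁻¹ * A l)

/-! ### The assembly (no zeroth-order term) -/

/-- **Rauch's linear step without zeroth-order term, from its two printed ingredients**: for
`A₀∂ₜv + Σⱼ Aⱼ∂ⱼv = 0` in Rauch's class at `0`, the `L¹` gradient estimate (5) at time `T`
makes `M_T(D) ∈ Hom(Lᵖ)` for every `1 < p ≤ 2` (`Rauch1986_L1GradientEstimate_imp_LpMultiplier`),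
in particular for `p = 3/2 ≠ 2`, and Brenner's Corollary 3.1
(`Rauch1986_LpMultiplier_forces_commutation`) gives the commutation relations (3). This is the
case `B₁ = 0` of `Rauch1986_linearL1EstimateForcesCommutation` — the case in which the printed
proof is complete (linearisations with `B′(ū) = 0`, e.g. every system of conservation laws
without source term); the case `B₁ ≠ 0` is not assembled (module docstring).
[cite: Rauch1986, Proof of Theorem p. 483; Brenner1973, Cor 3.1 p. 84] -/
theorem Rauch1986_linearL1EstimateForcesCommutation_zero_of_linearFacts
    (h₁ : Rauch1986_L1GradientEstimate_imp_LpMultiplier)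
    (h₂ : Rauch1986_LpMultiplier_forces_commutation) ⦃d k : ℕ⦄
    (A₀ : Matrix (Fin k) (Fin k) ℝ) (A : Fin d → Matrix (Fin k) (Fin k) ℝ)
    (hS : (ofConstant A₀ A 0).IsRauchClass 0) (c T : ℝ) (hc : 0 < c) (hT : 0 < T)
    (hyp : ∀ φ : Space d → Fin k → ℝ, ContDiff ℝ ∞ φ → HasCompactSupport φ →
      ∃ v : ℝ → Space d → Fin k → ℝ,
        (ofConstant A₀ A 0).IsClassicalSolution T v ∧ (∀ x, v 0 x = φ x) ∧
        HasCompactSupport (v T) ∧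
        ∫ x, ‖fderiv ℝ (v T) x‖ ≤ c * ∫ x, ‖fderiv ℝ φ x‖)
    (j l : Fin d) : Commute (A₀⁻¹ * A j) (A₀⁻¹ * A l) := by
  -- the exponent `p = 3/2`
  have hp₁ : (1 : ℝ≥0∞) < (3 / 2 : ℝ≥0) := by
    rw [← ENNReal.coe_one, ENNReal.coe_lt_coe]; norm_num
  have hp₂ : ((3 / 2 : ℝ≥0) : ℝ≥0∞) < 2 := by
    rw [show (2 : ℝ≥0∞) = ((2 : ℝ≥0) : ℝ≥0∞) from rfl, ENNReal.coe_lt_coe]; norm_num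
  have hM : IsLpMultiplier ((3 / 2 : ℝ≥0) : ℝ≥0∞) (rauchSymbol A₀ A 0 T) :=
    h₁ A₀ A hS c T hc hT hyp _ hp₁ hp₂.le
  exact h₂ A₀ A hS T _ hT hp₁ ENNReal.coe_lt_top hp₂.ne hM j l

end Literature.Barriers.AtomisticToContinuum

end
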